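import Literature.Probability.Percolation.BoxGatewayRarity
import Summits.CriticalPhenomena.PercolationContinuityZ3.Theorems.PercHyperscalingGluingFreeBoxShatteringFatLinkUniqueness

/-!
# The root skeleton of critical percolation on `ℤ³`, part 1: geometry and symmetry
# (supports crux `PercHyperscalingGluing.FreeBoxShattering`, stmt-CriticalPhenomena-4644, line `registered`)

A site `x` is a **`t`-root (axis `i`)** of `ω` if an `ω`-open lattice path of the half-space
`{z | x_i ≤ z_i}` joins `x` to a site `y` with `y_i ≥ x_i + t`; the **root skeleton** `S_t(ω)` is
the set of `t`-roots for some axis. (1) Deterministic (`extent_lt_of_walk`): an open lattice walk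
OFF the skeleton has every coordinate extent `< t` (its vertex `v` of minimal `i`-th coordinate is
no root and the walk runs in `{z | v_i ≤ z_i}`); hence a free piece is covered by the radius-`t`
cubes around its root and its own skeleton sites, `|K_Λ(x)| ≤ (2t+1)³(1 + #(S_t ∩ Λ))`
(`piece_subset_cover`, `card_piece_le'`). (2) Symmetry (`measure_armUp_le` = registered stub
`rootSkeleton_armUp_le`, every `p`): `P_p(x is a t-root in axis i) ≤ P_p(A_t)`,
`A_t = CerfDembinVanishing.halfSpaceReach 3 t`, by `z ↦ σ_i(z - x)` as in the tree's
`BoxGateway.measure_openConnVia_box_le_halfSpaceReach`; so `P_p(x ∈ S_t) ≤ 3P_p(A_t)` and at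
`p_c(ℤ³)` the skeleton is sparse (`skeleton_sparse_criticalProbI`, Barsky–Grimmett–Newman).
Part 2 (`…RootSkeletonBound.lean`) draws the first-moment consequence for dense free pieces
(twin census `Cruxes/FreeBoxSparse/STRATEGY-CENSUS.md` §4.2/§6). Def-free (local notation).
Refs: Grimmett, *Percolation* (1999) Thm (7.35); Cerf–Dembin, ECP 25 (2020) §2.
-/
noncomputable section

namespace Summit.CriticalPhenomena.PercolationContinuityZ3.Theorems.FreeBoxShattering

open MeasureTheory Filter
open Literature.Probability.Percolation Literature.Probability.LatticeModels
open Literature.Probability.Percolation.CerfDembinVanishing (halfSpaceReach)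
open scoped Topology Classical

/-! ### Local notation (no definitions) -/

/-- the upward half-space through `x` in axis `i` -/
local notation3 "Hup⟦" i ", " x "⟧" => {z : Site 3 | (x : Site 3) (i : Fin 3) ≤ z i}
/-- `x` is a `t`-root in axis `i`: an open lattice path of `Hup⟦i, x⟧` from `x` climbs to height
`≥ x_i + t` -/
local notation3 "armUp⟦" i ", " t ", " ω ", " x "⟧" =>
  (∃ y ∈ openClusterIn (withinGraph (zdGraph 3) Hup⟦i, x⟧) (ω : BondConfig (Site 3)) (x : Site 3),
    (x : Site 3) (i : Fin 3) + ((t : ℕ) : ℤ) ≤ y i)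
/-- `x` lies on the root skeleton `S_t(ω)` -/
local notation3 "skel⟦" t ", " ω ", " x "⟧" => (∃ i : Fin 3, armUp⟦i, t, ω, x⟧)
/-- the free piece of `x` in `Λ` -/
local notation3 "pieceF⟦" Λ ", " ω ", " x "⟧" =>
  (Finset.filter (fun v => (ω : BondConfig (Site 3)) ∈
    openConnIn (↑(Λ : Finset (Site 3)) : Set (Site 3)) x v) Λ)

namespace RootSkeleton

/-! ### Walks: elementary facts -/

/-- A walk of `K ⊓ withinGraph G R` started in `R` stays in `R`. [folklore] -/
theorem support_subset_of_walk_within {V : Type*} {K G : SimpleGraph V} {R : Set V} {u v : V}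
    (w : (K ⊓ withinGraph G R).Walk u v) (hu : u ∈ R) : ∀ z ∈ w.support, z ∈ R := by
  induction w with
  | nil => intro z hz; rw [SimpleGraph.Walk.support_nil, List.mem_singleton] at hz; rw [hz]; exact hu
  | @cons a b c hab p ih =>
    intro z hz
    rw [SimpleGraph.Walk.support_cons, List.mem_cons] at hz
    rcases hz with rfl | hz
    · exact hu
    · exact ih hab.2.2.2 z hz

/-- A walk of `K` whose vertices all lie in `R`, for `K ≤ G`, is a walk of `K ⊓ withinGraph G R`
up to reachability. [folklore] -/
theorem reachable_inf_withinGraph_of_support' {V : Type*} {K G : SimpleGraph V} (hKG : K ≤ G)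
    {u v : V} (w : K.Walk u v) {R : Set V} (h : ∀ z ∈ w.support, z ∈ R) :
    (K ⊓ withinGraph G R).Reachable u v := by
  induction w with
  | nil => rfl
  | @cons a b c hab p ih =>
    have ha : a ∈ R := h a (by simp)
    have hb : b ∈ R := h b (by simp [p.start_mem_support])
    have hadj : (K ⊓ withinGraph G R).Adj a b := by
      simp only [SimpleGraph.inf_adj, withinGraph_adj]
      exact ⟨hab, hKG hab, ha, hb⟩
    exact hadj.reachable.trans (ih fun z hz => h z (by simp [hz]))

/-- On a lattice configuration the open graph is a subgraph of `ℤ³`. [folklore] -/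
theorem openGraph_le_zdGraph {ω : BondConfig (Site 3)} (hω : ω ⊆ (zdGraph 3).edgeSet) :
    openGraph ω ≤ zdGraph 3 := fun a b hab =>
  (SimpleGraph.mem_edgeSet _).1 (hω ((openGraph_adj ω a b).1 hab).1)

/-! ### The extent bound off the skeleton (deterministic) -/

/-- **Off the skeleton, open lattice walks have coordinate extent `< t`.** If every vertex of an
open lattice walk from `x` to `y` is off `S_t(ω)`, then `y_i < x_i + t` and `x_i < y_i + t` for
every axis `i`: the vertex `v` minimising the `i`-th coordinate splits the walk into two walks of
the half-space `{z | v_i ≤ z_i}` started at `v`, and `v` is not a `t`-root. [folklore] -/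
theorem extent_lt_of_walk {ω : BondConfig (Site 3)} {t : ℕ} {x y : Site 3}
    (w : (openGraph ω ⊓ zdGraph 3).Walk x y) (hoff : ∀ z ∈ w.support, ¬ skel⟦t, ω, z⟧) (i : Fin 3) :
    y i < x i + t ∧ x i < y i + t := by
  classical
  -- the vertex of the walk with minimal `i`-th coordinate
  obtain ⟨v, hv, hmin⟩ := w.support.toFinset.exists_min_image (fun z : Site 3 => z i)
    ⟨x, List.mem_toFinset.2 w.start_mem_support⟩
  have hvs : v ∈ w.support := List.mem_toFinset.1 hv
  have hmin' : ∀ z ∈ w.support, v i ≤ z i := fun z hz => hmin z (List.mem_toFinset.2 hz)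
  have hvoff : ¬ armUp⟦i, t, ω, v⟧ := fun h => hoff v hvs ⟨i, h⟩
  -- both ends of the walk lie in the constrained cluster of `v` in `{z | v i ≤ z i}`
  have hK : openGraph ω ⊓ zdGraph 3 ≤ zdGraph 3 := inf_le_right
  have hreach : ∀ {u : Site 3} (w' : (openGraph ω ⊓ zdGraph 3).Walk v u),
      (∀ z ∈ w'.support, z ∈ w.support) →
        u ∈ openClusterIn (withinGraph (zdGraph 3) Hup⟦i, v⟧) ω v := by
    intro u w' hsub
    rw [mem_openClusterIn_iff]
    have h := reachable_inf_withinGraph_of_support' hK w' (R := Hup⟦i, v⟧)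
      (fun z hz => hmin' z (hsub z hz))
    refine h.mono ?_
    intro a b hab
    simp only [SimpleGraph.inf_adj, withinGraph_adj] at hab ⊢
    exact ⟨hab.1.1, hab.2⟩
  have hy : y ∈ openClusterIn (withinGraph (zdGraph 3) Hup⟦i, v⟧) ω v :=
    hreach (w.dropUntil v hvs) fun z hz => SimpleGraph.Walk.support_dropUntil_subset_support w hvs hz
  have hx : x ∈ openClusterIn (withinGraph (zdGraph 3) Hup⟦i, v⟧) ω v :=
    hreach (w.takeUntil v hvs).reverse fun z hz =>
      SimpleGraph.Walk.support_takeUntil_subset_support w hvs (by simpa using hz)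
  -- `v` is no `t`-root: neither end climbs to height `v i + t`
  have hy' : y i < v i + t := by by_contra hle; exact hvoff ⟨y, hy, not_lt.1 hle⟩
  have hx' : x i < v i + t := by by_contra hle; exact hvoff ⟨x, hx, not_lt.1 hle⟩
  have hvx : v i ≤ x i := hmin' x w.start_mem_support
  have hvy : v i ≤ y i := hmin' y w.end_mem_support
  constructor <;> omega

/-- **Cluster form.** For a site `v` off the skeleton, every site of the open lattice cluster of
`v` avoiding `S_t(ω)` differs from `v` by `< t` in each coordinate. [folklore] -/
theorem coord_lt_of_mem_offSkeleton {ω : BondConfig (Site 3)} {t : ℕ} {v u : Site 3}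
    (hv : ¬ skel⟦t, ω, v⟧)
    (hu : u ∈ openClusterIn (withinGraph (zdGraph 3) {z : Site 3 | ¬ skel⟦t, ω, z⟧}) ω v) (i : Fin 3) :
    u i < v i + t ∧ v i < u i + t := by
  rw [mem_openClusterIn_iff] at hu
  obtain ⟨w⟩ := hu
  have hsupp : ∀ z ∈ w.support, ¬ skel⟦t, ω, z⟧ :=
    support_subset_of_walk_within (K := openGraph ω) (G := zdGraph 3) w hv
  have hle : openGraph ω ⊓ withinGraph (zdGraph 3) {z : Site 3 | ¬ skel⟦t, ω, z⟧} ≤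
      openGraph ω ⊓ zdGraph 3 := by
    intro a b hab
    simp only [SimpleGraph.inf_adj, withinGraph_adj] at hab ⊢
    exact ⟨hab.1, hab.2.1⟩
  have hsupp' : ∀ z ∈ (w.mapLe hle).support, ¬ skel⟦t, ω, z⟧ := by
    rw [SimpleGraph.Walk.support_mapLe_eq_support]; exact hsupp
  exact extent_lt_of_walk (w.mapLe hle) hsupp' i

/-! ### Free pieces are covered by cubes around their skeleton sites -/

/-- A site within sup-distance `t` of `u` lies in the cube `Λ_t + u`. [folklore] -/
theorem mem_image_box_add_of_abs_le {t : ℕ} {u v : Site 3} (h : ∀ i, v i - u i ≤ t ∧ u i - v i ≤ t) :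
    v ∈ (box 3 t).image (· + u) := by
  refine Finset.mem_image.2 ⟨v - u, mem_box.2 fun i => ?_, sub_add_cancel v u⟩
  obtain ⟨h1, h2⟩ := h i
  simp only [Pi.sub_apply]
  constructor <;> omega

/-- **Covering a free piece.** On a lattice configuration, the free piece `K_Λ(x)` is covered by
the cube `Λ_t + x` and the cubes `Λ_t + u` around its own skeleton sites `u ∈ S_t(ω) ∩ K_Λ(x)`:
walk from `v ∈ K_Λ(x)` towards `x` inside `Λ`; either the walk never leaves the skeleton-avoiding
cluster of `v` (then `v` is `t`-close to `x`), or its first exit steps from a site `t`-close to `v`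
onto a skeleton site of the piece. [folklore] -/
theorem piece_subset_cover {ω : BondConfig (Site 3)} (hω : ω ⊆ (zdGraph 3).edgeSet) (t : ℕ)
    (Λ : Finset (Site 3)) (x : Site 3) :
    pieceF⟦Λ, ω, x⟧ ⊆ (box 3 t).image (· + x) ∪
      ((pieceF⟦Λ, ω, x⟧).filter fun u => skel⟦t, ω, u⟧).biUnion fun u => (box 3 t).image (· + u) := by
  classical
  intro v hv
  rw [Finset.mem_union, Finset.mem_biUnion]
  obtain ⟨hvΛ, hxv⟩ := Finset.mem_filter.1 hv
  -- if `v` itself is on the skeleton we are done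
  by_cases hvS : skel⟦t, ω, v⟧
  · refine Or.inr ⟨v, Finset.mem_filter.2 ⟨hv, hvS⟩, ?_⟩
    exact mem_image_box_add_of_abs_le fun i => by constructor <;> omega
  -- an open lattice walk from `v` to `x` inside `Λ`
  have hxΛ : x ∈ (↑Λ : Set (Site 3)) := by
    obtain ⟨hx, -, -⟩ := hxv; exact hx
  have hvx : v ∈ openClusterIn (withinGraph ⊤ (↑Λ : Set (Site 3))) ω x := by
    have h := hxv
    rw [openConnIn_eq_openConnVia hxΛ] at h
    exact h
  rw [mem_openClusterIn_iff] at hvx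
  obtain ⟨w₀⟩ := hvx
  -- every vertex of `w₀` lies in `Λ` and is joined to `x` inside `Λ`
  have hw₀Λ : ∀ z ∈ w₀.support, z ∈ (↑Λ : Set (Site 3)) :=
    support_subset_of_walk_within (K := openGraph ω) (G := ⊤) w₀ hxΛ
  have hpiece : ∀ z ∈ w₀.support, z ∈ pieceF⟦Λ, ω, x⟧ := by
    intro z hz
    refine Finset.mem_filter.2 ⟨Finset.mem_coe.1 (hw₀Λ z hz), ?_⟩
    have hle : openGraph ω ⊓ withinGraph ⊤ (↑Λ : Set (Site 3)) ≤ openGraph ω := inf_le_left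
    exact CerfDembinVanishing.mem_openConnIn_of_walk hle (w₀.takeUntil z hz) fun z' hz' =>
      hw₀Λ z' (SimpleGraph.Walk.support_takeUntil_subset_support w₀ hz hz')
  -- the same walk as an open lattice walk, reversed: from `v` to `x`
  have hle : openGraph ω ⊓ withinGraph ⊤ (↑Λ : Set (Site 3)) ≤ openGraph ω ⊓ zdGraph 3 := by
    intro a b hab
    simp only [SimpleGraph.inf_adj] at hab ⊢
    exact ⟨hab.1, openGraph_le_zdGraph hω hab.1⟩
  set w : (openGraph ω ⊓ zdGraph 3).Walk v x := (w₀.mapLe hle).reverse with hw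
  have hwsupp : ∀ z ∈ w.support, z ∈ pieceF⟦Λ, ω, x⟧ := by
    intro z hz
    rw [hw, SimpleGraph.Walk.support_reverse, List.mem_reverse, SimpleGraph.Walk.support_mapLe_eq_support] at hz
    exact hpiece z hz
  -- the skeleton-avoiding cluster of `v`
  set Q : Set (Site 3) := openClusterIn (withinGraph (zdGraph 3) {z : Site 3 | ¬ skel⟦t, ω, z⟧}) ω v
    with hQ
  by_cases hxQ : x ∈ Q
  · -- `v` is `t`-close to `x`
    left
    refine mem_image_box_add_of_abs_le fun i => ?_
    obtain ⟨h1, h2⟩ := coord_lt_of_mem_offSkeleton hvS hxQ i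
    constructor <;> omega
  · -- first exit of the walk from `Q`: a step `u' → u` with `u' ∈ Q`, `u ∉ Q`
    right
    have hvQ : v ∈ Q := self_mem_openClusterIn _ ω v
    obtain ⟨d, hd, hd1, hd2⟩ := w.exists_boundary_dart Q hvQ hxQ
    have hadj : (openGraph ω ⊓ zdGraph 3).Adj d.fst d.snd := d.adj
    simp only [SimpleGraph.inf_adj, openGraph_adj] at hadj
    -- `u = d.snd` is on the skeleton (else it would belong to `Q`)
    have hu'off : ¬ skel⟦t, ω, d.fst⟧ :=
      openClusterIn_withinGraph_subset (G := zdGraph 3) (R := {z : Site 3 | ¬ skel⟦t, ω, z⟧}) hvS ω hd1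
    have huS : skel⟦t, ω, d.snd⟧ := by
      by_contra huoff
      refine hd2 (mem_openClusterIn_of_adj hd1 ?_ hadj.1.1)
      rw [withinGraph_adj]
      exact ⟨hadj.2, hu'off, huoff⟩
    have husupp : d.snd ∈ w.support := w.dart_snd_mem_support_of_mem_darts hd
    refine ⟨d.snd, Finset.mem_filter.2 ⟨hwsupp _ husupp, huS⟩, ?_⟩
    -- `v` is `t`-close to `u'`, which is a neighbour of `u`
    refine mem_image_box_add_of_abs_le fun i => ?_
    obtain ⟨h1, h2⟩ := coord_lt_of_mem_offSkeleton hvS hd1 i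
    obtain ⟨h3, h4⟩ := FatLink.coord_sub_le_of_adj hadj.2 i
    constructor <;> omega

/-- **Size of a free piece in terms of its skeleton sites**: on a lattice configuration,
`|K_Λ(x)| ≤ (2t+1)³ (1 + #(S_t(ω) ∩ K_Λ(x)))`. [folklore] -/
theorem card_piece_le {ω : BondConfig (Site 3)} (hω : ω ⊆ (zdGraph 3).edgeSet) (t : ℕ)
    (Λ : Finset (Site 3)) (x : Site 3) :
    ((pieceF⟦Λ, ω, x⟧).card : ℝ) ≤
      (2 * (t : ℝ) + 1) ^ 3 * (1 + (((pieceF⟦Λ, ω, x⟧).filter fun u => skel⟦t, ω, u⟧).card : ℝ)) := by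
  classical
  have hcube : ∀ u : Site 3, ((box 3 t).image (· + u)).card ≤ (2 * t + 1) ^ 3 := fun u =>
    Finset.card_image_le.trans (card_box 3 t).le
  have h1 := Finset.card_le_card (piece_subset_cover hω t Λ x)
  have h2 := (h1.trans (Finset.card_union_le _ _))
  have h3 : (((pieceF⟦Λ, ω, x⟧).filter fun u => skel⟦t, ω, u⟧).biUnion fun u =>
      (box 3 t).image (· + u)).card ≤
      ((pieceF⟦Λ, ω, x⟧).filter fun u => skel⟦t, ω, u⟧).card * (2 * t + 1) ^ 3 :=
    Finset.card_biUnion_le_card_mul _ _ _ fun u _ => hcube u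
  have h4 : (pieceF⟦Λ, ω, x⟧).card ≤ (2 * t + 1) ^ 3 +
      ((pieceF⟦Λ, ω, x⟧).filter fun u => skel⟦t, ω, u⟧).card * (2 * t + 1) ^ 3 :=
    h2.trans (add_le_add (hcube x) h3)
  have h5 : ((pieceF⟦Λ, ω, x⟧).card : ℝ) ≤ (2 * (t : ℝ) + 1) ^ 3 +
      (((pieceF⟦Λ, ω, x⟧).filter fun u => skel⟦t, ω, u⟧).card : ℝ) * (2 * (t : ℝ) + 1) ^ 3 := by
    exact_mod_cast h4
  nlinarith [h5]

/-- The same with the skeleton sites counted in all of `Λ` (for `x ∈ Λ` the piece lies in `Λ`). [folklore] -/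
theorem card_piece_le' {ω : BondConfig (Site 3)} (hω : ω ⊆ (zdGraph 3).edgeSet) (t : ℕ)
    (Λ : Finset (Site 3)) (x : Site 3) :
    ((pieceF⟦Λ, ω, x⟧).card : ℝ) ≤
      (2 * (t : ℝ) + 1) ^ 3 * (1 + ((Λ.filter fun u => skel⟦t, ω, u⟧).card : ℝ)) := by
  classical
  refine (card_piece_le hω t Λ x).trans ?_
  have hsub : ((pieceF⟦Λ, ω, x⟧).filter fun u => skel⟦t, ω, u⟧) ⊆ (Λ.filter fun u => skel⟦t, ω, u⟧) :=
    Finset.filter_subset_filter _ (Finset.filter_subset _ Λ)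
  have h : (((pieceF⟦Λ, ω, x⟧).filter fun u => skel⟦t, ω, u⟧).card : ℝ) ≤
      ((Λ.filter fun u => skel⟦t, ω, u⟧).card : ℝ) := by exact_mod_cast Finset.card_le_card hsub
  have ht : (0 : ℝ) ≤ (2 * (t : ℝ) + 1) ^ 3 := by positivity
  nlinarith

/-! ### Symmetry: a `t`-root in any axis costs `P_p(A_t)` -/

/-- **`P_p(x is a t-root in axis i) ≤ P_p(A_t)`** (every `p`, every site, every axis): the lattice
automorphism `z ↦ σ(z - x)`, `σ` the coordinate permutation exchanging the axes `i` and `0`, maps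
`x` to `0`, the half-space `{z | x_i ≤ z_i}` onto `ℍ = {z | 0 ≤ z_0}` and a site of `i`-th
coordinate `≥ x_i + t` to a site of height `≥ t`; it preserves `P_p`
(`bondPercolation_map_relabel_iso`) and carries constrained clusters to constrained clusters
(`openClusterIn_relabel`) — the symmetry step of Cerf–Dembin 2020 §2 (eq1), as in the tree's
`BoxGateway.measure_openConnVia_box_le_halfSpaceReach`. [cite: CerfDembin2020, §2 ((eq1), symmetry of the lattice)] -/
theorem measure_armUp_le (p : unitInterval) (i : Fin 3) (t : ℕ) (x : Site 3) :
    bondPercolation (zdGraph 3) p {ω | armUp⟦i, t, ω, x⟧} ≤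
      bondPercolation (zdGraph 3) p (halfSpaceReach 3 t) := by
  -- the automorphism `ψ z = σ (z - x)`
  set π : Equiv.Perm (Fin 3) := Equiv.swap i 0 with hπ
  set ψ : zdGraph 3 ≃g zdGraph 3 := (zdShiftIso (-x)).trans (zdSignedPermIso π fun _ => 1) with hψ
  set e : Site 3 ≃ Site 3 := ψ.toEquiv with he
  have he_apply : ∀ y, e y = Site.signedPerm π (fun _ => 1) (y + -x) := fun y => rfl
  have he0 : ∀ y, e y 0 = y i - x i := fun y => by
    rw [he_apply, Site.signedPerm_apply, hπ, Equiv.symm_swap, Equiv.swap_apply_right]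
    simp [sub_eq_add_neg]
  have hex : e x = 0 := by rw [he_apply, add_neg_cancel, Site.signedPerm_zero]
  have hadj : ∀ u v, (zdGraph 3).Adj (e u) (e v) ↔ (zdGraph 3).Adj u v := fun u v => ψ.map_rel_iff'
  have hK : ∀ u v, (withinGraph (zdGraph 3) (e '' Hup⟦i, x⟧)).Adj (e u) (e v) ↔
      (withinGraph (zdGraph 3) Hup⟦i, x⟧).Adj u v := fun u v => by
    simp only [withinGraph_adj, e.injective.mem_set_image, hadj u v]
  have himg : e '' Hup⟦i, x⟧ ⊆ halfSpace 3 := by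
    rintro _ ⟨y, hy, rfl⟩
    change 0 ≤ e y 0
    rw [he0]
    have : x i ≤ y i := hy
    linarith
  -- the inclusion of events
  have hsub : {ω | armUp⟦i, t, ω, x⟧} ⊆ BondConfig.relabel (sym2Equiv e) ⁻¹' halfSpaceReach 3 t := by
    rintro ω ⟨y, hy, hyt⟩
    have hrel := openClusterIn_relabel e hK ω x
    have hmem : e y ∈ openClusterIn (withinGraph (zdGraph 3) (e '' Hup⟦i, x⟧))
        (BondConfig.relabel (sym2Equiv e) ω) 0 := by
      have h := Set.mem_image_of_mem e hy
      rwa [← hrel, hex] at h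
    refine ⟨e y, openClusterIn_mono_graph (withinGraph_mono _ himg) _ 0 hmem, ?_⟩
    rw [he0]
    linarith
  calc bondPercolation (zdGraph 3) p {ω | armUp⟦i, t, ω, x⟧}
      ≤ bondPercolation (zdGraph 3) p (BondConfig.relabel (sym2Equiv e) ⁻¹' halfSpaceReach 3 t) :=
        measure_mono hsub
    _ = (bondPercolation (zdGraph 3) p).map (BondConfig.relabel (sym2Equiv e)) (halfSpaceReach 3 t) :=
        (MeasurableEquiv.map_apply _ _).symm
    _ = bondPercolation (zdGraph 3) p (halfSpaceReach 3 t) := by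
        rw [he, bondPercolation_map_relabel_iso ψ p]

/-- The `t`-root event of a site in one axis is measurable (a countable union of constrained
connection events). [folklore] -/
theorem measurableSet_armUp (i : Fin 3) (t : ℕ) (x : Site 3) :
    MeasurableSet {ω : BondConfig (Site 3) | armUp⟦i, t, ω, x⟧} := by
  have h : {ω : BondConfig (Site 3) | armUp⟦i, t, ω, x⟧} =
      ⋃ y ∈ {y : Site 3 | x i + (t : ℤ) ≤ y i},
        openConnVia (withinGraph (zdGraph 3) Hup⟦i, x⟧) x y := by
    ext ω
    simp only [Set.mem_setOf_eq, Set.mem_iUnion, openConnVia, exists_prop]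
    exact ⟨fun ⟨y, hy, hn⟩ => ⟨y, hn, hy⟩, fun ⟨y, hn, hy⟩ => ⟨y, hy, hn⟩⟩
  rw [h]
  exact MeasurableSet.biUnion (Set.to_countable _) fun y _ => measurableSet_openConnVia _ _ _

/-- The skeleton event of a site is measurable. [folklore] -/
theorem measurableSet_skel (t : ℕ) (x : Site 3) :
    MeasurableSet {ω : BondConfig (Site 3) | skel⟦t, ω, x⟧} := by
  have h : {ω : BondConfig (Site 3) | skel⟦t, ω, x⟧} = ⋃ i : Fin 3, {ω | armUp⟦i, t, ω, x⟧} := by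
    ext ω; simp only [Set.mem_setOf_eq, Set.mem_iUnion]
  rw [h]
  exact MeasurableSet.iUnion fun i => measurableSet_armUp i t x

/-- **Density of the skeleton**: `P_p(x ∈ S_t) ≤ 3 P_p(A_t)` for every site `x` (union over the
three axes). [folklore] -/
theorem real_skel_le (p : unitInterval) (t : ℕ) (x : Site 3) :
    (bondPercolation (zdGraph 3) p).real {ω | skel⟦t, ω, x⟧} ≤
      3 * (bondPercolation (zdGraph 3) p).real (halfSpaceReach 3 t) := by
  set P := bondPercolation (zdGraph 3) p with hP
  have h : {ω : BondConfig (Site 3) | skel⟦t, ω, x⟧} = ⋃ i : Fin 3, {ω | armUp⟦i, t, ω, x⟧} := by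
    ext ω; simp only [Set.mem_setOf_eq, Set.mem_iUnion]
  have h1 : P.real (⋃ i : Fin 3, {ω | armUp⟦i, t, ω, x⟧}) ≤ ∑ i : Fin 3, P.real {ω | armUp⟦i, t, ω, x⟧} :=
    measureReal_iUnion_fintype_le _
  have h2 : ∀ i : Fin 3, P.real {ω | armUp⟦i, t, ω, x⟧} ≤ P.real (halfSpaceReach 3 t) := fun i =>
    ENNReal.toReal_mono (measure_ne_top _ _) (measure_armUp_le p i t x)
  rw [h]
  calc P.real (⋃ i : Fin 3, {ω | armUp⟦i, t, ω, x⟧})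
      ≤ ∑ i : Fin 3, P.real {ω | armUp⟦i, t, ω, x⟧} := h1
    _ ≤ ∑ _i : Fin 3, P.real (halfSpaceReach 3 t) := Finset.sum_le_sum fun i _ => h2 i
    _ = 3 * P.real (halfSpaceReach 3 t) := by simp [Finset.sum_const, Finset.card_univ]

end RootSkeleton

/-- **Registered stub `rootSkeleton_armUp_le`** (every `p`): the probability that `x` is a
`t`-root in axis `i` — joined inside the half-space `{z | x_i ≤ z_i}` by an open lattice path to
height `≥ x_i + t` — is at most `P_p(A_t)`, `A_t = halfSpaceReach 3 t`. [cite: CerfDembin2020, §2 ((eq1), symmetry of the lattice)] -/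
theorem rootSkeleton_armUp_le : ∀ (p : unitInterval) (i : Fin 3) (t : ℕ) (x : Site 3),
    bondPercolation (zdGraph 3) p
        {ω : BondConfig (Site 3) | ∃ y ∈ openClusterIn (withinGraph (zdGraph 3) {z : Site 3 | x i ≤ z i}) ω x,
          x i + (t : ℤ) ≤ y i} ≤
      bondPercolation (zdGraph 3) p (Literature.Probability.Percolation.CerfDembinVanishing.halfSpaceReach 3 t) :=
  RootSkeleton.measure_armUp_le

/-- **The skeleton is sparse at `p_c(ℤ³)`**: for every `ε > 0` there is `t` such that every site lies
on the root skeleton `S_t` with probability `≤ ε` (Barsky–Grimmett–Newman: `θ_ℍ(p_c) = 0`, so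
`P_{p_c}(A_t) → 0`), while — deterministically, `RootSkeleton.extent_lt_of_walk` — deleting `S_t(ω)`
leaves only open lattice clusters of coordinate extent `< t`. [cite: BarskyGrimmettNewman1991, Thm 1.1] -/
theorem skeleton_sparse_criticalProbI {ε : ℝ} (hε : 0 < ε) : ∃ t : ℕ, ∀ x : Site 3,
    (bondPercolation (zdGraph 3) (criticalProbI 3)).real
      {ω : BondConfig (Site 3) | ∃ i : Fin 3,
        ∃ y ∈ openClusterIn (withinGraph (zdGraph 3) {z : Site 3 | x i ≤ z i}) ω x, x i + (t : ℤ) ≤ y i} ≤ ε := by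
  have hlim := CerfDembinVanishing.tendsto_measure_halfSpaceReach (d := 3) (criticalProbI 3)
    BarskyGrimmettNewman1991_Z3_holds
  have hε3 : (0 : ENNReal) < ENNReal.ofReal (ε / 3) := by
    rw [ENNReal.ofReal_pos]; positivity
  obtain ⟨t, ht⟩ := (ENNReal.tendsto_atTop_zero.1 hlim) _ hε3
  refine ⟨t, fun x => ?_⟩
  have h1 := RootSkeleton.real_skel_le (criticalProbI 3) t x
  have h2 : (bondPercolation (zdGraph 3) (criticalProbI 3)).real (halfSpaceReach 3 t) ≤ ε / 3 := by
    rw [measureReal_def]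
    have := ht t le_rfl
    calc ((bondPercolation (zdGraph 3) (criticalProbI 3)) (halfSpaceReach 3 t)).toReal
        ≤ (ENNReal.ofReal (ε / 3)).toReal := ENNReal.toReal_mono ENNReal.ofReal_ne_top this
      _ = ε / 3 := ENNReal.toReal_ofReal (by positivity)
  linarith

end Summit.CriticalPhenomena.PercolationContinuityZ3.Theorems.FreeBoxShattering

end
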